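/- Fleet seat `ym-wcr-19608-p2` (g2), route `WeakCouplingRates`, cruxes `ColdBoxTwoPointFloorW` (stmt-QuantumFields-19608) and
`BulkDominatesColdBoxW` (stmt-QuantumFields-19609): the ϑ-DATUM pass of the one-scale trunk, SPLIT IDENTITIES (T2a/T2b) + density identity. -/
import Summits.QuantumFields.YangMills.Theorems.WeakCouplingRatesColdBoxOneScaleDatumDefs
import Summits.QuantumFields.YangMills.Theorems.WeakCouplingRatesColdBoxGaussRef
import Summits.QuantumFields.YangMills.Theorems.WeakCouplingRatesBulkDominatesColdBoxWKernelTransport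

/-!
# The one-scale expansion with an exterior datum: the two split identities and the density identity

Objects: `…ColdBoxOneScaleDatumDefs` (`extDatum`, `sdat`, `meanT`, `chartCfgD`, `cfgTD`, `qObsD`, `goodTD`, `tiltWD`).  This file proves the
two small NEW identities of the datum pass (stub-critic STUB-PLAN rev 2 §T2, evidence #34 on stmt-QuantumFields-19609) and the datum twin
of the density identity `boltzmann_mul_gnomonicDensity_eq` of `…ColdBoxGaussRef`:

* `formM_dir_eq_sum_touching_add` (**T2b**) — the pinned Maxwell form of the enlarged box WITH DATUM splits as
  `M_θ(s) = Σ_{q touching Λ} sCirc(glue θ s)(q)² + (M_θ(0) − Σ_{q touching Λ} sCirc(glue θ 0)(q)²)`: the plaquettes of the enlarged box not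
  touching the cold box `Λ` have only pinned edges, so their contribution is `s`-independent (at `θ = 0` it is `0`: `formM_dir_eq_sum_touching`);
* `sqrt_mul_sCirc_extDatum_eq` (**T2a**) — on a plaquette all of whose edges lie in the enlarged box (e.g. every plaquette touching `Λ`),
  `√(2β) · sCirc(colour c of extDatum ϑᵀ ((t + μ')/√(2β)))(p) = sCirc(glue ϑ'_c (mean ϑ'_c + t_c))(p)` provided `ϑ = 0` on the temporal forest
  (edgewise: `sqrt_mul_extDatum_unscaleT_eq`); squared and summed over colours: `β · Σ_c sCirc(chart data_c)(p)² = qObsD p t`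
  (`beta_mul_sum_sCirc_extDatum_sq_eq`);
* `sum_qObsD_eq` — completing the square (`formM_eq_sq_of_posDef`, `posDef_dirQmat`) colour by colour:
  `Σ_{q touching} qObsD q t = ½ Σ_c t_cᵀ Q_D t_c + K₀(β,H,ϑ)`, `K₀` a `t`-independent constant; hence
  `Π_c gaussWeight_{Q_D}(t_c) = exp(−Σ_{q touching} qObsD q t + K₀)` (`prod_gaussWeight_eq_exp_qObsD`);
* `exists_boltzmann_mul_gnomonicDensity_datum_eq` — **the density identity with datum**: there is `C = C(β,H,ϑ) ∈ (0,∞)` with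
  `e^{−β S_Λ(cfgTD t)} · Π_{e free} gnomonicDensity((t+μ')_e/√(2β)) = C · Π_c gaussWeight_{Q_D}(t_c) · e^{tiltWD t}` for every centred colour
  triple `t` (the mean shift sits inside `cfgTD`; the Gaussian reference stays the UNshifted `gauss3 H`; `C` cancels in normalised expectations).
No sorry; no new definition; standard axioms.  NOT a claim about the mass gap.
-/

set_option autoImplicit false

noncomputable section

open MeasureTheory Finset
open scoped ENNReal Matrix
open Literature.Probability.LatticeModels (Site halfOpenBox)
open Literature.MathematicalPhysics.QuantumLattice
open Literature.MathematicalPhysics.QuantumFieldTheory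
open Literature.MathematicalPhysics.QuantumFieldTheory.LatticeMaxwell
open Literature.MathematicalPhysics.QuantumFieldTheory.AxialGauge
open Literature.MathematicalPhysics.QuantumFieldTheory.GaussianToolkit

namespace Summit.QuantumFields.YangMills.Theorems.WeakCouplingRates

variable {H : ℕ}

/-! ## T2b — the Maxwell form with datum splits off an `s`-independent constant -/

/-- Off the cold box the glued field of the Dirichlet problem with datum does not read the free variables. -/
theorem glue_dir_congr_of_not_mem (θ : Literature.MathematicalPhysics.QuantumLattice.ZdEdge 4 → ℝ) (s s' : DirFree H → ℝ)
    {e : Literature.MathematicalPhysics.QuantumLattice.ZdEdge 4} (he : e ∉ boxEdges 4 (2 * H + 1)) :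
    glue (pin := fun e => e ∉ dirFreeEdges H) dirCorner (2 * H + 3) θ s e =
      glue (pin := fun e => e ∉ dirFreeEdges H) dirCorner (2 * H + 3) θ s' e := by
  have hpin : e ∉ dirFreeEdges H := fun hf => he (mem_dirFreeEdges.1 hf).1
  by_cases hb : e ∈ boxEdgesAt dirCorner (2 * H + 3)
  · rw [glue_apply_pin _ _ hb hpin, glue_apply_pin _ _ hb hpin]
  · rw [glue_apply_of_not_mem _ _ hb, glue_apply_of_not_mem _ _ hb]

/-- A plaquette of `ℤ⁴` that does not touch the cold box has datum-only circulation: it does not read the free variables. -/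
theorem sCirc_glue_dir_congr_of_not_touching (θ : Literature.MathematicalPhysics.QuantumLattice.ZdEdge 4 → ℝ) (s s' : DirFree H → ℝ)
    {p : ZdPlaquette 4} (hp : p ∉ plaquettesTouching (boxEdges 4 (2 * H + 1))) :
    sCirc (glue (pin := fun e => e ∉ dirFreeEdges H) dirCorner (2 * H + 3) θ s) (p.1, p.2.1.1, p.2.1.2) =
      sCirc (glue (pin := fun e => e ∉ dirFreeEdges H) dirCorner (2 * H + 3) θ s') (p.1, p.2.1.1, p.2.1.2) := by
  rw [mem_plaquettesTouching_iff, Finset.not_nonempty_iff_eq_empty] at hp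
  have hnot : ∀ e ∈ plaquetteEdges p, e ∉ boxEdges 4 (2 * H + 1) := fun e he hmem => by
    have : e ∈ plaquetteEdges p ∩ boxEdges 4 (2 * H + 1) := Finset.mem_inter.2 ⟨he, hmem⟩
    rw [hp] at this; simp at this
  have h1 := glue_dir_congr_of_not_mem θ s s' (hnot (p.1, p.2.1.1) (by simp [plaquetteEdges]))
  have h2 := glue_dir_congr_of_not_mem θ s s' (hnot (p.1 + Pi.single p.2.1.1 1, p.2.1.2) (by simp [plaquetteEdges]))
  have h3 := glue_dir_congr_of_not_mem θ s s' (hnot (p.1 + Pi.single p.2.1.2 1, p.2.1.1) (by simp [plaquetteEdges]))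
  have h4 := glue_dir_congr_of_not_mem θ s s' (hnot (p.1, p.2.1.2) (by simp [plaquetteEdges]))
  simp only [sCirc, h1, h2, h3, h4]

/-- **T2b — the Maxwell form with datum, split along the plaquettes touching the cold box**:
`M_θ(s) = Σ_{q touching Λ} sCirc(glue θ s)(q)² + (M_θ(0) − Σ_{q touching Λ} sCirc(glue θ 0)(q)²)` — the plaquettes of the enlarged box NOT
touching `Λ` have only pinned edges, so their (datum-only) contribution does not depend on `s` (at `θ = 0` it vanishes:
`formM_dir_eq_sum_touching`). -/
theorem formM_dir_eq_sum_touching_add (θ : Literature.MathematicalPhysics.QuantumLattice.ZdEdge 4 → ℝ) (s : DirFree H → ℝ) :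
    formM (fun e => e ∉ dirFreeEdges H) dirCorner (2 * H + 3) θ s =
      (∑ p ∈ plaquettesTouching (boxEdges 4 (2 * H + 1)),
          (sCirc (glue (pin := fun e => e ∉ dirFreeEdges H) dirCorner (2 * H + 3) θ s) (p.1, p.2.1.1, p.2.1.2)) ^ 2) +
        (formM (fun e => e ∉ dirFreeEdges H) dirCorner (2 * H + 3) θ 0 -
          ∑ p ∈ plaquettesTouching (boxEdges 4 (2 * H + 1)),
            (sCirc (glue (pin := fun e => e ∉ dirFreeEdges H) dirCorner (2 * H + 3) θ 0) (p.1, p.2.1.1, p.2.1.2)) ^ 2) := by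
  classical
  -- the split of the enlarged box's plaquettes into the image of the touching ones and the rest
  set I := (plaquettesTouching (boxEdges 4 (2 * H + 1))).image
    (fun p : ZdPlaquette 4 => ((p.1 - dirCorner, p.2.1.1, p.2.1.2) : Plaq 4)) with hI
  have hIsub : I ⊆ plaquettesIn (halfOpenBox 4 (2 * H + 3)) := by
    intro q hq
    rw [hI, mem_image] at hq
    obtain ⟨p, hp, rfl⟩ := hq
    exact unshift_mem_plaquettesIn hp
  -- the touching part, for any free variables `u`
  have htouch : ∀ u : DirFree H → ℝ,
      ∑ q ∈ I, sCirc (glue (pin := fun e => e ∉ dirFreeEdges H) dirCorner (2 * H + 3) θ u) (Plaq.shift dirCorner q) ^ 2 =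
        ∑ p ∈ plaquettesTouching (boxEdges 4 (2 * H + 1)),
          (sCirc (glue (pin := fun e => e ∉ dirFreeEdges H) dirCorner (2 * H + 3) θ u) (p.1, p.2.1.1, p.2.1.2)) ^ 2 := by
    intro u
    rw [hI, sum_image (fun p _ q _ h => unshift_dirCorner_injective h)]
    exact sum_congr rfl fun p _ => by rw [shift_unshift_dirCorner]
  -- the rest does not depend on `u`
  have hrest : ∀ u : DirFree H → ℝ,
      ∑ q ∈ plaquettesIn (halfOpenBox 4 (2 * H + 3)) \ I,
          sCirc (glue (pin := fun e => e ∉ dirFreeEdges H) dirCorner (2 * H + 3) θ u) (Plaq.shift dirCorner q) ^ 2 =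
        ∑ q ∈ plaquettesIn (halfOpenBox 4 (2 * H + 3)) \ I,
          sCirc (glue (pin := fun e => e ∉ dirFreeEdges H) dirCorner (2 * H + 3) θ 0) (Plaq.shift dirCorner q) ^ 2 := by
    intro u
    refine sum_congr rfl fun q hq => ?_
    rw [mem_sdiff] at hq
    obtain ⟨hqin, hqI⟩ := hq
    have hlt : q.2.1 < q.2.2 := (Plaq.mem_plaquettesIn.1 hqin).2.1
    set p : ZdPlaquette 4 := (q.1 + dirCorner, ⟨(q.2.1, q.2.2), hlt⟩) with hpdef
    have hq' : ((p.1 - dirCorner, p.2.1.1, p.2.1.2) : Plaq 4) = q := by simp [hpdef]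
    have hp : p ∉ plaquettesTouching (boxEdges 4 (2 * H + 1)) := fun h => hqI (by rw [hI]; exact mem_image.2 ⟨p, h, hq'⟩)
    have hshift : Plaq.shift dirCorner q = (p.1, p.2.1.1, p.2.1.2) := by rw [← hq', shift_unshift_dirCorner]
    rw [hshift, sCirc_glue_dir_congr_of_not_touching θ u 0 hp]
  have hsplit : ∀ u : DirFree H → ℝ, formM (fun e => e ∉ dirFreeEdges H) dirCorner (2 * H + 3) θ u =
      (∑ p ∈ plaquettesTouching (boxEdges 4 (2 * H + 1)),
          (sCirc (glue (pin := fun e => e ∉ dirFreeEdges H) dirCorner (2 * H + 3) θ u) (p.1, p.2.1.1, p.2.1.2)) ^ 2) +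
        ∑ q ∈ plaquettesIn (halfOpenBox 4 (2 * H + 3)) \ I,
          sCirc (glue (pin := fun e => e ∉ dirFreeEdges H) dirCorner (2 * H + 3) θ 0) (Plaq.shift dirCorner q) ^ 2 := by
    intro u
    rw [formM, ← sum_sdiff hIsub, htouch u, hrest u, add_comm]
  rw [hsplit s, hsplit 0]
  ring

/-! ## T2a — the circulation split: chart circulations with datum are (background + fluctuation)/√(2β) -/

/-- The free index of the Dirichlet problem and of the forest gauge fixing label the same edge (through `dirFreeEquiv`). -/
theorem dirFreeEquiv_symm_eq (e : Literature.MathematicalPhysics.QuantumLattice.ZdEdge 4) (he : e ∈ boxEdges 4 (2 * H + 1))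
    (hf : ¬ (e.2 = 0 ∧ ∀ k : Fin 4, 1 ≤ e.1 k ∧ e.1 k + 1 ≤ 2 * (H : ℤ))) :
    (dirFreeEquiv H).symm ⟨⟨e, he⟩, hf⟩ =
      ⟨⟨e, boxEdges_subset_boxEdgesAt_dirCorner H he⟩, not_not.2 (mem_dirFreeEdges.2 ⟨he, by simpa using hf⟩)⟩ := rfl

/-- **Edgewise form of T2a**: on every edge of the enlarged box, `√(2β) · extDatum ϑᵀ (unscaleT β s) e c = glue ϑ'_c (s_c) e`
(`ϑ' = sdat β ϑ`), provided `ϑ` vanishes on the temporal forest. -/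
theorem sqrt_mul_extDatum_unscaleT_eq {β : ℝ} (hβ : 0 < β) (ϑ : Fin 3 → (Literature.MathematicalPhysics.QuantumLattice.ZdEdge 4 → ℝ))
    (hforest : ∀ x : Site 4, (∀ k : Fin 4, 1 ≤ x k ∧ x k + 1 ≤ 2 * (H : ℤ)) → ∀ c, ϑ c (x, 0) = 0)
    (s : TSpace H) (c : Fin 3) {e : Literature.MathematicalPhysics.QuantumLattice.ZdEdge 4}
    (he : e ∈ boxEdgesAt dirCorner (2 * H + 3)) :
    Real.sqrt (2 * β) * extDatum (fun e c => ϑ c e) (unscaleT H β s) e c =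
      glue (pin := fun e => e ∉ dirFreeEdges H) dirCorner (2 * H + 3) (sdat β ϑ c) (WithLp.ofLp (s c)) e := by
  have hc : Real.sqrt (2 * β) ≠ 0 := (Real.sqrt_pos.2 (by linarith)).ne'
  by_cases hΛ : e ∈ boxEdges 4 (2 * H + 1)
  · by_cases hf : (e.2 = 0 ∧ ∀ k : Fin 4, 1 ≤ e.1 k ∧ e.1 k + 1 ≤ 2 * (H : ℤ))
    · -- forest edge: both sides vanish
      obtain ⟨x, j⟩ := e
      obtain ⟨hj, hx⟩ := hf
      simp only at hj hx
      subst hj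
      have hpin : (x, (0 : Fin 4)) ∉ dirFreeEdges H := fun hmem => (mem_dirFreeEdges.1 hmem).2 ⟨rfl, by exact_mod_cast hx⟩
      rw [extDatum_of_forest _ _ hx, glue_apply_pin _ _ he hpin, sdat_apply, hforest x hx c]
      simp
    · -- free edge
      have hfree : e ∈ dirFreeEdges H := mem_dirFreeEdges.2 ⟨hΛ, by simpa using hf⟩
      have key : extDatum (fun e c => ϑ c e) (unscaleT H β s) e c = unscaleT H β s ⟨⟨e, hΛ⟩, hf⟩ c := by
        have := extDatum_apply_free (fun e c => ϑ c e) (unscaleT H β s) ⟨⟨e, hΛ⟩, hf⟩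
        rw [this]
      rw [key, unscaleT, dirFreeEquiv_symm_eq e hΛ hf,
        glue_apply_free (sdat β ϑ c) (WithLp.ofLp (s c)) ⟨⟨e, he⟩, not_not.2 hfree⟩]
      field_simp
  · -- exterior edge of the enlarged box: the datum
    have hpin : e ∉ dirFreeEdges H := fun hmem => hΛ (mem_dirFreeEdges.1 hmem).1
    rw [extDatum_of_not_mem _ _ hΛ, glue_apply_pin _ _ he hpin, sdat_apply]

/-- **T2a — the circulation split**: on a plaquette all of whose edges lie in the enlarged box, the chart circulation of `cfgTD`'s data is
`(background + fluctuation)/√(2β)`: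
`√(2β) · sCirc (colour c of extDatum ϑᵀ (unscaleT β (t + μ'))) p = sCirc (glue ϑ'_c (mean ϑ'_c + t_c)) p`. -/
theorem sqrt_mul_sCirc_extDatum_eq {β : ℝ} (hβ : 0 < β) (ϑ : Fin 3 → (Literature.MathematicalPhysics.QuantumLattice.ZdEdge 4 → ℝ))
    (hforest : ∀ x : Site 4, (∀ k : Fin 4, 1 ≤ x k ∧ x k + 1 ≤ 2 * (H : ℤ)) → ∀ c, ϑ c (x, 0) = 0)
    (t : TSpace H) (c : Fin 3) {p : Plaq 4}
    (hp : (p.1, p.2.1) ∈ boxEdgesAt dirCorner (2 * H + 3) ∧ (p.1 + Pi.single p.2.1 1, p.2.2) ∈ boxEdgesAt dirCorner (2 * H + 3) ∧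
      (p.1 + Pi.single p.2.2 1, p.2.1) ∈ boxEdgesAt dirCorner (2 * H + 3) ∧ (p.1, p.2.2) ∈ boxEdgesAt dirCorner (2 * H + 3)) :
    Real.sqrt (2 * β) * sCirc (fun e => extDatum (fun e c => ϑ c e) (unscaleT H β (t + meanT H β ϑ)) e c) p =
      sCirc (glue (pin := fun e => e ∉ dirFreeEdges H) dirCorner (2 * H + 3) (sdat β ϑ c)
        (mean (fun e => e ∉ dirFreeEdges H) dirCorner (2 * H + 3) (sdat β ϑ c) + WithLp.ofLp (t c))) p := by
  obtain ⟨h1, h2, h3, h4⟩ := hp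
  have hs : WithLp.ofLp ((t + meanT H β ϑ) c) =
      mean (fun e => e ∉ dirFreeEdges H) dirCorner (2 * H + 3) (sdat β ϑ c) + WithLp.ofLp (t c) := by
    rw [Pi.add_apply, WithLp.ofLp_add, meanT_apply, add_comm]
  rw [← hs]
  simp only [sCirc, mul_sub, mul_add, sqrt_mul_extDatum_unscaleT_eq hβ ϑ hforest _ c h1,
    sqrt_mul_extDatum_unscaleT_eq hβ ϑ hforest _ c h2, sqrt_mul_extDatum_unscaleT_eq hβ ϑ hforest _ c h3,
    sqrt_mul_extDatum_unscaleT_eq hβ ϑ hforest _ c h4]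

/-- T2a for a plaquette touching the cold box (all its edges lie in the enlarged box), squared and summed over the colours:
`β · Σ_c sCirc(chart data_c)(p)² = qObsD p t`. -/
theorem beta_mul_sum_sCirc_extDatum_sq_eq {β : ℝ} (hβ : 0 < β) (ϑ : Fin 3 → (Literature.MathematicalPhysics.QuantumLattice.ZdEdge 4 → ℝ))
    (hforest : ∀ x : Site 4, (∀ k : Fin 4, 1 ≤ x k ∧ x k + 1 ≤ 2 * (H : ℤ)) → ∀ c, ϑ c (x, 0) = 0)
    (t : TSpace H) {p : ZdPlaquette 4} (hp : p ∈ plaquettesTouching (boxEdges 4 (2 * H + 1))) :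
    β * ∑ c, (sCirc (fun e => extDatum (fun e c => ϑ c e) (unscaleT H β (t + meanT H β ϑ)) e c) (p.1, p.2.1.1, p.2.1.2)) ^ 2 =
      qObsD H β ϑ (p.1, p.2.1.1, p.2.1.2) t := by
  have hE : ((p.1, p.2.1.1) ∈ boxEdgesAt dirCorner (2 * H + 3) ∧
      (p.1 + Pi.single p.2.1.1 1, p.2.1.2) ∈ boxEdgesAt dirCorner (2 * H + 3) ∧
      (p.1 + Pi.single p.2.1.2 1, p.2.1.1) ∈ boxEdgesAt dirCorner (2 * H + 3) ∧ (p.1, p.2.1.2) ∈ boxEdgesAt dirCorner (2 * H + 3)) :=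
    ⟨plaquetteEdges_subset_enlarged hp (by simp [plaquetteEdges]), plaquetteEdges_subset_enlarged hp (by simp [plaquetteEdges]),
      plaquetteEdges_subset_enlarged hp (by simp [plaquetteEdges]), plaquetteEdges_subset_enlarged hp (by simp [plaquetteEdges])⟩
  have h2 : (2 : ℝ) * β = Real.sqrt (2 * β) ^ 2 := (Real.sq_sqrt (by linarith)).symm
  rw [qObsD, Finset.mul_sum, Finset.mul_sum]
  refine Finset.sum_congr rfl fun c _ => ?_
  rw [← sqrt_mul_sCirc_extDatum_eq hβ ϑ hforest t c (p := ((p.1, p.2.1.1, p.2.1.2) : Plaq 4)) hE, mul_pow, ← h2]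
  ring

/-! ## The quadratic surrogates with datum sum to the centred Gaussian exponent plus a constant -/

/-- **Completing the square, summed over the touching plaquettes**:
`Σ_{q touching Λ} qObsD q t = ½ Σ_c t_cᵀ Q_D t_c + K₀(β,H,ϑ)` with the `t`-independent constant
`K₀ = ½ Σ_c (K_{ϑ'_c} − (M_{ϑ'_c}(0) − Σ_{q touching} sCirc(glue ϑ'_c 0)(q)²))`. -/
theorem sum_qObsD_eq (β : ℝ) (ϑ : Fin 3 → (Literature.MathematicalPhysics.QuantumLattice.ZdEdge 4 → ℝ)) (t : TSpace H) :
    ∑ q ∈ plaquettesTouching (boxEdges 4 (2 * H + 1)), qObsD H β ϑ (q.1, q.2.1.1, q.2.1.2) t =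
      (∑ c, (WithLp.ofLp (t c) ⬝ᵥ Qmat (fun e => e ∉ dirFreeEdges H) dirCorner (2 * H + 3) *ᵥ WithLp.ofLp (t c)) / 2) +
        (∑ c, (Kconst (fun e => e ∉ dirFreeEdges H) dirCorner (2 * H + 3) (sdat β ϑ c) -
          (formM (fun e => e ∉ dirFreeEdges H) dirCorner (2 * H + 3) (sdat β ϑ c) 0 -
            ∑ p ∈ plaquettesTouching (boxEdges 4 (2 * H + 1)),
              (sCirc (glue (pin := fun e => e ∉ dirFreeEdges H) dirCorner (2 * H + 3) (sdat β ϑ c) 0) (p.1, p.2.1.1, p.2.1.2)) ^ 2))) / 2 := by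
  -- swap the sums
  have hswap : ∑ q ∈ plaquettesTouching (boxEdges 4 (2 * H + 1)), qObsD H β ϑ (q.1, q.2.1.1, q.2.1.2) t =
      ∑ c, (∑ q ∈ plaquettesTouching (boxEdges 4 (2 * H + 1)),
        (sCirc (glue (pin := fun e => e ∉ dirFreeEdges H) dirCorner (2 * H + 3) (sdat β ϑ c)
          (mean (fun e => e ∉ dirFreeEdges H) dirCorner (2 * H + 3) (sdat β ϑ c) + WithLp.ofLp (t c))) (q.1, q.2.1.1, q.2.1.2)) ^ 2) / 2 := by
    simp only [qObsD, Finset.mul_sum]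
    rw [Finset.sum_comm]
    refine Finset.sum_congr rfl fun c _ => ?_
    rw [Finset.sum_div]
    exact Finset.sum_congr rfl fun q _ => by ring
  rw [hswap, ← Finset.sum_div, ← Finset.sum_div, ← add_div, ← Finset.sum_add_distrib]
  congr 1
  refine Finset.sum_congr rfl fun c _ => ?_
  -- one colour: T2b + completing the square at `s = μ + t_c`
  have hsq := formM_eq_sq_of_posDef (posDef_dirQmat H) (sdat β ϑ c)
    (mean (fun e => e ∉ dirFreeEdges H) dirCorner (2 * H + 3) (sdat β ϑ c) + WithLp.ofLp (t c))
  rw [add_sub_cancel_left] at hsq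
  have hsplit := formM_dir_eq_sum_touching_add (H := H) (sdat β ϑ c)
    (mean (fun e => e ∉ dirFreeEdges H) dirCorner (2 * H + 3) (sdat β ϑ c) + WithLp.ofLp (t c))
  linarith

/-- The product of the one-colour Gaussian weights in terms of the surrogates with datum:
`Π_c gaussWeight_{Q_D}(t_c) = exp(−Σ_{q touching} qObsD q t + K₀)`. -/
theorem prod_gaussWeight_eq_exp_qObsD (β : ℝ) (ϑ : Fin 3 → (Literature.MathematicalPhysics.QuantumLattice.ZdEdge 4 → ℝ)) (t : TSpace H) :
    ∏ i, gaussWeight (Qmat (fun e => e ∉ dirFreeEdges H) dirCorner (2 * H + 3)) (t i) =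
      ENNReal.ofReal (Real.exp (-(∑ q ∈ plaquettesTouching (boxEdges 4 (2 * H + 1)), qObsD H β ϑ (q.1, q.2.1.1, q.2.1.2) t) +
        (∑ c, (Kconst (fun e => e ∉ dirFreeEdges H) dirCorner (2 * H + 3) (sdat β ϑ c) -
          (formM (fun e => e ∉ dirFreeEdges H) dirCorner (2 * H + 3) (sdat β ϑ c) 0 -
            ∑ p ∈ plaquettesTouching (boxEdges 4 (2 * H + 1)),
              (sCirc (glue (pin := fun e => e ∉ dirFreeEdges H) dirCorner (2 * H + 3) (sdat β ϑ c) 0) (p.1, p.2.1.1, p.2.1.2)) ^ 2))) / 2)) := by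
  simp only [gaussWeight]
  rw [← ENNReal.ofReal_prod_of_nonneg (fun i _ => (Real.exp_pos _).le), ← Real.exp_sum]
  congr 2
  rw [sum_qObsD_eq]
  simp only [neg_div, Finset.sum_neg_distrib]
  ring

/-! ## The density identity with datum -/

/-- The real form of the density identity with datum: pointwise in `t`,
`e^{−β S_Λ(cfgTD t)} · Π_e (2π²)⁻¹(1+|w_e|²)⁻² = (2π²)^{−n} · exp(−Σ_touching qObsD q t) · e^{tiltWD t}`, `w = unscaleT β (t + μ')`. -/
theorem boltzmann_mul_gnomonicDensity_datum_eq_real (β : ℝ) (ϑ : Fin 3 → (Literature.MathematicalPhysics.QuantumLattice.ZdEdge 4 → ℝ))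
    (t : TSpace H) :
    Real.exp (-β * wilsonBoundaryAction (fundamentalRep (Fin 2)) (boxEdges 4 (2 * H + 1)) (cfgTD H β ϑ t)) *
        ∏ e : ColdFreeIdx H, (1 / (2 * Real.pi ^ 2) * ((1 + ∑ k, (unscaleT H β (t + meanT H β ϑ) e k) ^ 2)⁻¹) ^ 2) =
      (1 / (2 * Real.pi ^ 2)) ^ Fintype.card (ColdFreeIdx H) *
        (Real.exp (-(∑ q ∈ plaquettesTouching (boxEdges 4 (2 * H + 1)), qObsD H β ϑ (q.1, q.2.1.1, q.2.1.2) t)) *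
          Real.exp (tiltWD H β ϑ t)) := by
  have hJ : Real.exp (∑ e : ColdFreeIdx H, Real.log (((1 + ∑ k, (unscaleT H β (t + meanT H β ϑ) e k) ^ 2)⁻¹) ^ 2)) =
      ∏ e : ColdFreeIdx H, ((1 + ∑ k, (unscaleT H β (t + meanT H β ϑ) e k) ^ 2)⁻¹) ^ 2 := by
    rw [Real.exp_sum]
    exact Finset.prod_congr rfl fun e _ => Real.exp_log (by positivity)
  have hexp : Real.exp (-(∑ q ∈ plaquettesTouching (boxEdges 4 (2 * H + 1)), qObsD H β ϑ (q.1, q.2.1.1, q.2.1.2) t)) *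
      Real.exp (∑ q ∈ plaquettesTouching (boxEdges 4 (2 * H + 1)),
        (qObsD H β ϑ (q.1, q.2.1.1, q.2.1.2) t - β * plaqCostAt (fundamentalRep (Fin 2)) q.1 q.2.1.1 q.2.1.2 (cfgTD H β ϑ t))) =
      Real.exp (-β * ∑ q ∈ plaquettesTouching (boxEdges 4 (2 * H + 1)),
        plaqCostAt (fundamentalRep (Fin 2)) q.1 q.2.1.1 q.2.1.2 (cfgTD H β ϑ t)) := by
    rw [← Real.exp_add]
    congr 1
    rw [neg_mul, Finset.mul_sum, Finset.sum_sub_distrib]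
    ring
  rw [wilsonBoundaryAction_eq_sum_plaqCostAt, Finset.prod_mul_distrib, Finset.prod_const, Finset.card_univ, tiltWD,
    Real.exp_add, hJ]
  linear_combination (-((1 / (2 * Real.pi ^ 2)) ^ Fintype.card (ColdFreeIdx H) *
    ∏ e : ColdFreeIdx H, ((1 + ∑ k, (unscaleT H β (t + meanT H β ϑ) e k) ^ 2)⁻¹) ^ 2)) * hexp

/-- **The density identity with datum**: there is a constant `C = C(β,H,ϑ) ∈ (0,∞)` with, for every centred colour triple `t`,
`e^{−β S_Λ(cfgTD t)} · Π_{e free} gnomonicDensity((t+μ')_e/√(2β)) = C · Π_c gaussWeight_{Q_D}(t_c) · e^{tiltWD t}`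
(`C = (2π²)^{−n} e^{−K₀}`, the completed-square constant of the datum; it cancels in every normalised expectation). -/
theorem exists_boltzmann_mul_gnomonicDensity_datum_eq (β : ℝ) (ϑ : Fin 3 → (Literature.MathematicalPhysics.QuantumLattice.ZdEdge 4 → ℝ)) :
    ∃ C : ℝ≥0∞, C ≠ 0 ∧ C ≠ ∞ ∧ ∀ t : TSpace H,
      ENNReal.ofReal (Real.exp (-β * wilsonBoundaryAction (fundamentalRep (Fin 2)) (boxEdges 4 (2 * H + 1)) (cfgTD H β ϑ t))) *
          ∏ e : ColdFreeIdx H, gnomonicDensity (unscaleT H β (t + meanT H β ϑ) e) =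
        C * (∏ i, gaussWeight (Qmat (fun e => e ∉ dirFreeEdges H) dirCorner (2 * H + 3)) (t i)) *
          ENNReal.ofReal (Real.exp (tiltWD H β ϑ t)) := by
  set K₀ : ℝ := (∑ c, (Kconst (fun e => e ∉ dirFreeEdges H) dirCorner (2 * H + 3) (sdat β ϑ c) -
    (formM (fun e => e ∉ dirFreeEdges H) dirCorner (2 * H + 3) (sdat β ϑ c) 0 -
      ∑ p ∈ plaquettesTouching (boxEdges 4 (2 * H + 1)),
        (sCirc (glue (pin := fun e => e ∉ dirFreeEdges H) dirCorner (2 * H + 3) (sdat β ϑ c) 0) (p.1, p.2.1.1, p.2.1.2)) ^ 2))) / 2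
    with hK₀
  refine ⟨ENNReal.ofReal ((1 / (2 * Real.pi ^ 2)) ^ Fintype.card (ColdFreeIdx H) * Real.exp (-K₀)),
    ENNReal.ofReal_ne_zero_iff.2 (by positivity), ENNReal.ofReal_ne_top, fun t => ?_⟩
  have hdens : ∀ e : ColdFreeIdx H, gnomonicDensity (unscaleT H β (t + meanT H β ϑ) e) =
      ENNReal.ofReal (1 / (2 * Real.pi ^ 2) * ((1 + ∑ k, (unscaleT H β (t + meanT H β ϑ) e k) ^ 2)⁻¹) ^ 2) := fun e => by
    rw [gnomonicDensity, ← ENNReal.ofReal_mul (by positivity)]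
  simp only [hdens]
  rw [← ENNReal.ofReal_prod_of_nonneg (fun e _ => by positivity), ← ENNReal.ofReal_mul (Real.exp_pos _).le,
    boltzmann_mul_gnomonicDensity_datum_eq_real, prod_gaussWeight_eq_exp_qObsD β ϑ t, ← ENNReal.ofReal_mul (by positivity),
    ← ENNReal.ofReal_mul (by positivity)]
  congr 1
  rw [← hK₀, Real.exp_add, Real.exp_neg K₀]
  have hK : Real.exp K₀ ≠ 0 := (Real.exp_pos _).ne'
  field_simp

end Summit.QuantumFields.YangMills.Theorems.WeakCouplingRates

end
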